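import Mathlib

/-!
# B3RoomFloor — the structural remark behind LEMMA ROOM FLOOR (memo B3-ORPHANPAIR-monad1-g8 §2.7 (vi))

Kernel-checked, model-free part of the remark «no κ column is room-proof by letter type»:
on X = S₁ × S₂ × S₃ × S₄ the Künneth summands of H²(X, ⊠_g A_g) are indexed by multidegrees
j : Fin 4 → Fin 3 with Σ_g j_g = 2, and every such j has j_g = 0 on AT LEAST TWO factors
(`two_zero_slots`); hence if h²(⊠ A_g) = Σ_{|j|=2} ∏_g h^{j_g}(A_g) is positive, then h⁰(A_g) > 0 on
at least two factors (`h2_pos_needs_two_h0`).  For difference letters of one-phase LINE letters,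
h⁰ > 0 means a ZERO or effective-NULL letter — a degenerate one (D² = 0), whose cohomology a
non-special (resp. non-zero) Pic⁰ twist annihilates (TWIST-MONOTONE); the indefinite letters, the only
twist-blind ones, have h⁰ = 0.  So every K(x,x′)-carrying pair of THEOREM ORPHAN-PAIR lives on ≥ 2
twist-sensitive factors, and room-uniform statements come only from the specialness a room class
encodes (𝓡_sp), never from letter types.  Abstract h-vectors: `hv g d` = h^d of the factor-g letter.
No `sorry`, no `native_decide`; `decide` on the 81 multidegrees only.
-/

namespace Summit.Ventures.HSemireg.B3RoomFloor

open Finset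

/-- the multidegrees of total degree 2 on four factors -/
def deg2 : Finset (Fin 4 → Fin 3) := univ.filter fun j => (∑ g, (j g : ℕ)) = 2

/-- number of factors on which the multidegree is 0 (i.e. uses h⁰ of that factor) -/
def zeroSlots (j : Fin 4 → Fin 3) : ℕ := (univ.filter fun g => j g = 0).card

theorem deg2_card : deg2.card = 10 := by decide

/-- every total-degree-2 multidegree on four factors vanishes on at least two factors -/
theorem two_zero_slots : ∀ j : Fin 4 → Fin 3, (∑ g, (j g : ℕ)) = 2 → 2 ≤ zeroSlots j := by
  decide

/-- h² of a four-fold exterior tensor product by Künneth, from abstract factor h-vectors -/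
def h2 (hv : Fin 4 → Fin 3 → ℕ) : ℕ := ∑ j ∈ deg2, ∏ g, hv g (j g)

/-- the factors whose letter has a non-zero h⁰ (for one-phase difference letters: ZERO or effective NULL) -/
def h0Support (hv : Fin 4 → Fin 3 → ℕ) : Finset (Fin 4) := univ.filter fun g => 0 < hv g 0

/-- STRUCTURAL REMARK: a positive h² needs h⁰ > 0 on at least two factors. -/
theorem h2_pos_needs_two_h0 (hv : Fin 4 → Fin 3 → ℕ) (h : 0 < h2 hv) :
    2 ≤ (h0Support hv).card := by
  -- a positive sum has a positive summand
  have hex : ∃ j ∈ deg2, 0 < ∏ g, hv g (j g) := by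
    by_contra hne
    push Not at hne
    have : h2 hv = 0 := by
      unfold h2
      apply Finset.sum_eq_zero
      intro j hj
      exact Nat.le_zero.mp (hne j hj)
    omega
  obtain ⟨j, hj, hprod⟩ := hex
  -- every factor of a positive product is positive
  have hfac : ∀ g, 0 < hv g (j g) := by
    intro g
    rcases Nat.eq_zero_or_pos (hv g (j g)) with h0 | hpos
    · exfalso
      have : ∏ g, hv g (j g) = 0 := Finset.prod_eq_zero (Finset.mem_univ g) h0
      omega
    · exact hpos
  -- the zero slots of j lie in the h⁰-support
  have hsub : (univ.filter fun g => j g = 0) ⊆ h0Support hv := by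
    intro g hg
    simp only [Finset.mem_filter, Finset.mem_univ, true_and] at hg
    simp only [h0Support, Finset.mem_filter, Finset.mem_univ, true_and]
    have := hfac g
    rw [hg] at this
    exact this
  have hdeg : (∑ g, (j g : ℕ)) = 2 := by
    simp only [deg2, Finset.mem_filter, Finset.mem_univ, true_and] at hj
    exact hj
  calc 2 ≤ zeroSlots j := two_zero_slots j hdeg
    _ ≤ (h0Support hv).card := Finset.card_le_card hsub

/-- the indefinite letter type (0,n,0) has h⁰ = 0: a pair all of whose factors are indefinite has h² = 0 -/
theorem h2_indefinite_zero (n : Fin 4 → ℕ) :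
    h2 (fun g d => if d = 1 then n g else 0) = 0 := by
  by_contra hne
  have hpos : 0 < h2 (fun g d => if d = 1 then n g else 0) := Nat.pos_of_ne_zero hne
  have h2le := h2_pos_needs_two_h0 _ hpos
  have : h0Support (fun g d => if d = 1 then n g else 0) = ∅ := by
    ext g; simp [h0Support]
  rw [this] at h2le
  simp at h2le

/-- sanity: the N18 same-phase pair of the TWIST ray (letters (0,4,0),(0,4,0),(1,2,1),(1,2,1)) has h² = 16,
    and its h⁰-support is exactly the two common side factors (the fragile set Z). -/
theorem h2_n18_pair :
    h2 (fun g d => if g = 0 ∨ g = 1 then (if d = 1 then 4 else 0) else (if d = 1 then 2 else 1)) = 16 := by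
  decide

theorem h0Support_n18_pair :
    (h0Support (fun g d => if g = 0 ∨ g = 1 then (if d = 1 then 4 else 0) else (if d = 1 then 2 else 1))).card = 2 := by
  decide

end Summit.Ventures.HSemireg.B3RoomFloor
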